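import Mathlib
import Summits.Schanuel.Schanuel.Theorems.RigidCoreDefs
import Summits.Schanuel.Schanuel.Theorems.AclSubsetLogFreeCore.Negative.LogFreeCoreObjects

/-!
# Line `generic-period-fibre` (route `RigidCore`): EA-construction sequences exhaust the core `M`

Registered stub `stub_kernelFreeCore_exhaust` (S3a) of line `generic-period-fibre` of crux
`stmt-Schanuel-0970` (`Summit.Schanuel.Schanuel.Theses.RigidCore.SchanuelOnLogFreeCore`): the
STRUCTURE LEMMA for the kernel-free core
`M = sInf {K | K exp-closed ∧ K relatively algebraically closed in ℂ}`
(`Summit.Schanuel.Schanuel.Theorems.RigidCore.kernelFreeCore`, file `RigidCoreDefs`): every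
`a ∈ M` is a member of a finite **EA-construction sequence** `l = (l₀, …, l_{k-1})`, each
`l_j` ALGEBRAIC over `ℚ(l_i, exp l_i : i < j)`.  Throughout, "`l : Fin k → ℂ` is a
construction sequence" is written out verbatim as in the registered statement,
`∀ j : Fin k, IsAlgebraic ℚ(l '' {i | i < j} ∪ exp '' (l '' {i | i < j})) (l j)`
(no predicate is introduced; lemma names say `isConstr`).

Proof (folklore — the exponential-algebraic closure is reached by finite chains; cf. J. Kirby,
*Exponential algebraicity in exponential fields*, Bull. LMS 42 (2010) §3): the set `H` of members
of construction sequences is an intermediate field (`Exhaust.exists_constrField`: CONCATENATE the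
sequences of `a` and `b` (`Exhaust.isConstr_append`) and APPEND `a + b`, `a * b`, `a⁻¹`, which
lie in the field generated by the concatenation, `Exhaust.isConstr_snoc`); it is `exp`-closed
(append `exp a`) and relatively algebraically closed (a polynomial over `H` has finitely many
coefficients; concatenating their sequences gives ONE sequence `l` over whose field
`ℚ(range l, exp range l)` the polynomial is defined; append the root — no transitivity of
algebraicity is needed).  Hence `M ≤ H`, `M` being an `sInf` (`kernelFreeCore_le`).  Conversely
members of construction sequences lie in every `exp`-closed relatively algebraically closed field
(`Exhaust.mem_of_isConstr`, well-founded induction along the sequence), so `H = M`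
(`Exhaust.mem_kernelFreeCore_iff_exists_isConstr`) and in particular
`Exhaust.mem_kernelFreeCore_of_isConstr` (the form used by the NoPi calibration, stub S3 of the
line).

No definition is introduced: the field `H` enters only through the existence statement
`Exhaust.exists_constrField` (with its membership characterisation), and `H = M` is
`Exhaust.mem_kernelFreeCore_iff_exists_isConstr`.  NOT claimed: anything on minimality or
uniqueness of sequences, transcendence degrees, or any Schanuel-type statement (stubs A, B of the
line are open and are not used here).
-/

noncomputable section

namespace Summit.Schanuel.Schanuel.Theorems.RigidCore

open Summit.Schanuel.Schanuel.Theorems.AclSubsetLogFreeCore.Negative (isAlgebraic_of_le)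

namespace Exhaust

/-! ### The fields `ℚ(S, exp S)` -/

/-- `ℚ(S, exp S)` is monotone in `S`. -/
theorem adjoin_exp_mono {S T : Set ℂ} (h : S ⊆ T) :
    IntermediateField.adjoin ℚ (S ∪ Complex.exp '' S) ≤
      IntermediateField.adjoin ℚ (T ∪ Complex.exp '' T) :=
  IntermediateField.adjoin.mono ℚ _ _ (Set.union_subset_union h (Set.image_mono h))

/-- Algebraicity over `ℚ(S, exp S)` is monotone in `S`. -/
theorem isAlgebraic_mono {S T : Set ℂ} (h : S ⊆ T) {w : ℂ}
    (hw : IsAlgebraic (IntermediateField.adjoin ℚ (S ∪ Complex.exp '' S)) w) :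
    IsAlgebraic (IntermediateField.adjoin ℚ (T ∪ Complex.exp '' T)) w :=
  isAlgebraic_of_le (adjoin_exp_mono h) hw

/-- `S ⊆ ℚ(S, exp S)`. -/
theorem mem_adjoin_exp {S : Set ℂ} {a : ℂ} (ha : a ∈ S) :
    a ∈ IntermediateField.adjoin ℚ (S ∪ Complex.exp '' S) :=
  IntermediateField.subset_adjoin ℚ _ (Or.inl ha)

/-- `exp S ⊆ ℚ(S, exp S)`. -/
theorem exp_mem_adjoin_exp {S : Set ℂ} {a : ℂ} (ha : a ∈ S) :
    Complex.exp a ∈ IntermediateField.adjoin ℚ (S ∪ Complex.exp '' S) :=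
  IntermediateField.subset_adjoin ℚ _ (Or.inr ⟨a, ha, rfl⟩)

/-- `ℚ(S, exp S) ≤ K` whenever `S ⊆ K` and `K` is closed under `exp`. -/
theorem adjoin_exp_le {S : Set ℂ} {K : IntermediateField ℚ ℂ}
    (hexp : ∀ w ∈ K, Complex.exp w ∈ K) (hS : S ⊆ K) :
    IntermediateField.adjoin ℚ (S ∪ Complex.exp '' S) ≤ K := by
  refine IntermediateField.adjoin_le_iff.2 (Set.union_subset hS ?_)
  rintro _ ⟨a, ha, rfl⟩
  exact hexp a (hS ha)

/-! ### Construction sequences: members lie in closed fields; concatenation; extension -/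

/-- Members of a construction sequence lie in every `exp`-closed, relatively algebraically closed
intermediate field (well-founded induction along the sequence). -/
theorem mem_of_isConstr {k : ℕ} {l : Fin k → ℂ}
    (hl : ∀ j : Fin k, IsAlgebraic ↥(IntermediateField.adjoin ℚ
      (l '' {i | i < j} ∪ Complex.exp '' (l '' {i | i < j}))) (l j))
    {K : IntermediateField ℚ ℂ} (hexp : ∀ w ∈ K, Complex.exp w ∈ K)
    (halg : ∀ w : ℂ, IsAlgebraic K w → w ∈ K) (j : Fin k) : l j ∈ K := by
  induction j using WellFoundedLT.induction with
  | ind j ih =>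
    refine halg _ (isAlgebraic_of_le (adjoin_exp_le hexp ?_) (hl j))
    rintro _ ⟨i, hi, rfl⟩
    exact ih i hi

/-- **Members of construction sequences lie in the kernel-free core `M`.** -/
theorem mem_kernelFreeCore_of_isConstr {k : ℕ} {l : Fin k → ℂ}
    (hl : ∀ j : Fin k, IsAlgebraic ↥(IntermediateField.adjoin ℚ
      (l '' {i | i < j} ∪ Complex.exp '' (l '' {i | i < j}))) (l j))
    (j : Fin k) : l j ∈ kernelFreeCore :=
  mem_of_isConstr hl (fun _ hw => exp_mem_kernelFreeCore hw)
    (fun _ hw => mem_kernelFreeCore_of_isAlgebraic hw) j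

/-- The empty sequence is a construction sequence. -/
theorem isConstr_zero :
    ∀ j : Fin 0, IsAlgebraic ↥(IntermediateField.adjoin ℚ
      ((Fin.elim0 : Fin 0 → ℂ) '' {i | i < j} ∪
        Complex.exp '' ((Fin.elim0 : Fin 0 → ℂ) '' {i | i < j})))
      ((Fin.elim0 : Fin 0 → ℂ) j) :=
  fun j => j.elim0

/-- Appending to a construction sequence `l` a tuple `l'`, each of whose terms `l' j` is algebraic
over `ℚ(range l ∪ {l' i : i < j}, exp of these)`, gives a construction sequence. -/
theorem isConstr_append_of {k k' : ℕ} {l : Fin k → ℂ} {l' : Fin k' → ℂ}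
    (hl : ∀ j : Fin k, IsAlgebraic ↥(IntermediateField.adjoin ℚ
      (l '' {i | i < j} ∪ Complex.exp '' (l '' {i | i < j}))) (l j))
    (hl' : ∀ j : Fin k', IsAlgebraic ↥(IntermediateField.adjoin ℚ
      ((Set.range l ∪ l' '' {i | i < j}) ∪ Complex.exp '' (Set.range l ∪ l' '' {i | i < j})))
      (l' j)) :
    ∀ j : Fin (k + k'), IsAlgebraic ↥(IntermediateField.adjoin ℚ
      (Fin.append l l' '' {i | i < j} ∪ Complex.exp '' (Fin.append l l' '' {i | i < j})))
      (Fin.append l l' j) := by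
  intro j
  induction j using Fin.addCases with
  | left i =>
    rw [Fin.append_left]
    refine isAlgebraic_mono ?_ (hl i)
    rintro _ ⟨i', hi', rfl⟩
    exact ⟨Fin.castAdd k' i', Fin.strictMono_castAdd k' hi', Fin.append_left l l' i'⟩
  | right i =>
    rw [Fin.append_right]
    refine isAlgebraic_mono ?_ (hl' i)
    rintro _ (⟨i', rfl⟩ | ⟨i', hi', rfl⟩)
    · refine ⟨Fin.castAdd k' i', ?_, Fin.append_left l l' i'⟩
      show Fin.castAdd k' i' < Fin.natAdd k i
      rw [Fin.lt_def, Fin.val_castAdd, Fin.val_natAdd]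
      omega
    · exact ⟨Fin.natAdd k i', (Fin.natAdd_lt_natAdd_iff k).2 hi', Fin.append_right l l' i'⟩

/-- CONCATENATION of construction sequences. -/
theorem isConstr_append {k k' : ℕ} {l : Fin k → ℂ} {l' : Fin k' → ℂ}
    (hl : ∀ j : Fin k, IsAlgebraic ↥(IntermediateField.adjoin ℚ
      (l '' {i | i < j} ∪ Complex.exp '' (l '' {i | i < j}))) (l j))
    (hl' : ∀ j : Fin k', IsAlgebraic ↥(IntermediateField.adjoin ℚ
      (l' '' {i | i < j} ∪ Complex.exp '' (l' '' {i | i < j}))) (l' j)) :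
    ∀ j : Fin (k + k'), IsAlgebraic ↥(IntermediateField.adjoin ℚ
      (Fin.append l l' '' {i | i < j} ∪ Complex.exp '' (Fin.append l l' '' {i | i < j})))
      (Fin.append l l' j) :=
  isConstr_append_of hl fun j => isAlgebraic_mono Set.subset_union_right (hl' j)

/-- EXTENSION of a construction sequence by an element algebraic over `ℚ(range l, exp range l)`.
-/
theorem isConstr_snoc {k : ℕ} {l : Fin k → ℂ}
    (hl : ∀ j : Fin k, IsAlgebraic ↥(IntermediateField.adjoin ℚ
      (l '' {i | i < j} ∪ Complex.exp '' (l '' {i | i < j}))) (l j))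
    {w : ℂ} (hw : IsAlgebraic
      ↥(IntermediateField.adjoin ℚ (Set.range l ∪ Complex.exp '' Set.range l)) w) :
    ∀ j : Fin (k + 1), IsAlgebraic ↥(IntermediateField.adjoin ℚ
      (Fin.append l (fun _ : Fin 1 => w) '' {i | i < j} ∪
        Complex.exp '' (Fin.append l (fun _ : Fin 1 => w) '' {i | i < j})))
      (Fin.append l (fun _ : Fin 1 => w) j) :=
  isConstr_append_of hl fun _ => isAlgebraic_mono Set.subset_union_left hw

/-- `range l ⊆ range (append l l')`. -/
theorem range_left_subset {α : Type*} {k k' : ℕ} (l : Fin k → α) (l' : Fin k' → α) :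
    Set.range l ⊆ Set.range (Fin.append l l') := by
  rintro _ ⟨i, rfl⟩
  exact ⟨Fin.castAdd k' i, Fin.append_left l l' i⟩

/-- `range l' ⊆ range (append l l')`. -/
theorem range_right_subset {α : Type*} {k k' : ℕ} (l : Fin k → α) (l' : Fin k' → α) :
    Set.range l' ⊆ Set.range (Fin.append l l') := by
  rintro _ ⟨i, rfl⟩
  exact ⟨Fin.natAdd k i, Fin.append_right l l' i⟩

/-- EXTENSION PRINCIPLE: an element algebraic over `ℚ(range l, exp range l)`, `l` a construction
sequence, is a member of a construction sequence. -/
theorem exists_isConstr_of_isAlgebraic {k : ℕ} {l : Fin k → ℂ}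
    (hl : ∀ j : Fin k, IsAlgebraic ↥(IntermediateField.adjoin ℚ
      (l '' {i | i < j} ∪ Complex.exp '' (l '' {i | i < j}))) (l j))
    {w : ℂ} (hw : IsAlgebraic
      ↥(IntermediateField.adjoin ℚ (Set.range l ∪ Complex.exp '' Set.range l)) w) :
    ∃ (k : ℕ) (l : Fin k → ℂ), (∀ j : Fin k, IsAlgebraic ↥(IntermediateField.adjoin ℚ
      (l '' {i | i < j} ∪ Complex.exp '' (l '' {i | i < j}))) (l j)) ∧
      w ∈ Set.range l :=
  ⟨k + 1, _, isConstr_snoc hl hw, range_right_subset l (fun _ : Fin 1 => w) ⟨0, rfl⟩⟩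

/-- … in particular an element of `ℚ(range l, exp range l)`. -/
theorem exists_isConstr_of_mem {k : ℕ} {l : Fin k → ℂ}
    (hl : ∀ j : Fin k, IsAlgebraic ↥(IntermediateField.adjoin ℚ
      (l '' {i | i < j} ∪ Complex.exp '' (l '' {i | i < j}))) (l j))
    {w : ℂ}
    (hw : w ∈ IntermediateField.adjoin ℚ (Set.range l ∪ Complex.exp '' Set.range l)) :
    ∃ (k : ℕ) (l : Fin k → ℂ), (∀ j : Fin k, IsAlgebraic ↥(IntermediateField.adjoin ℚ
      (l '' {i | i < j} ∪ Complex.exp '' (l '' {i | i < j}))) (l j)) ∧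
      w ∈ Set.range l :=
  exists_isConstr_of_isAlgebraic hl (isAlgebraic_algebraMap
    (⟨w, hw⟩ : IntermediateField.adjoin ℚ (Set.range l ∪ Complex.exp '' Set.range l)))

/-- Two members of construction sequences are members of ONE construction sequence. -/
theorem exists_isConstr_pair {a b : ℂ}
    (ha : ∃ (k : ℕ) (l : Fin k → ℂ),
      (∀ j : Fin k, IsAlgebraic ↥(IntermediateField.adjoin ℚ
        (l '' {i | i < j} ∪ Complex.exp '' (l '' {i | i < j}))) (l j)) ∧ a ∈ Set.range l)
    (hb : ∃ (k : ℕ) (l : Fin k → ℂ),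
      (∀ j : Fin k, IsAlgebraic ↥(IntermediateField.adjoin ℚ
        (l '' {i | i < j} ∪ Complex.exp '' (l '' {i | i < j}))) (l j)) ∧ b ∈ Set.range l) :
    ∃ (k : ℕ) (l : Fin k → ℂ), (∀ j : Fin k, IsAlgebraic ↥(IntermediateField.adjoin ℚ
      (l '' {i | i < j} ∪ Complex.exp '' (l '' {i | i < j}))) (l j)) ∧
      a ∈ Set.range l ∧ b ∈ Set.range l := by
  obtain ⟨k, l, hl, ha⟩ := ha
  obtain ⟨k', l', hl', hb⟩ := hb
  exact ⟨k + k', Fin.append l l', isConstr_append hl hl', range_left_subset l l' ha,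
    range_right_subset l l' hb⟩

/-- Finitely many members of construction sequences are members of ONE construction sequence. -/
theorem exists_isConstr_finset {ι : Type*} (s : Finset ι) (f : ι → ℂ)
    (hf : ∀ i ∈ s, ∃ (k : ℕ) (l : Fin k → ℂ),
      (∀ j : Fin k, IsAlgebraic ↥(IntermediateField.adjoin ℚ
        (l '' {i | i < j} ∪ Complex.exp '' (l '' {i | i < j}))) (l j)) ∧ f i ∈ Set.range l) :
    ∃ (k : ℕ) (l : Fin k → ℂ), (∀ j : Fin k, IsAlgebraic ↥(IntermediateField.adjoin ℚ
      (l '' {i | i < j} ∪ Complex.exp '' (l '' {i | i < j}))) (l j)) ∧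
      ∀ i ∈ s, f i ∈ Set.range l := by
  classical
  induction s using Finset.induction_on with
  | empty => exact ⟨0, Fin.elim0, isConstr_zero, by simp⟩
  | insert a s _ ih =>
    obtain ⟨k, l, hl, hs⟩ := ih fun i hi => hf i (Finset.mem_insert_of_mem hi)
    obtain ⟨k', l', hl', ha⟩ := hf a (Finset.mem_insert_self a s)
    refine ⟨k + k', Fin.append l l', isConstr_append hl hl', fun i hi => ?_⟩
    rcases Finset.mem_insert.1 hi with rfl | hi
    · exact range_right_subset l l' ha
    · exact range_left_subset l l' (hs i hi)

/-! ### The intermediate field of members of construction sequences -/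

/-- The members of EA-construction sequences form an intermediate field `H` of `ℂ/ℚ`
(closure under the field operations: concatenate the sequences and append the new element).
Stated as an existence so that no definition is introduced; `H = M` by
`mem_kernelFreeCore_iff_exists_isConstr`. -/
theorem exists_constrField : ∃ H : IntermediateField ℚ ℂ, ∀ a : ℂ,
    a ∈ H ↔ ∃ (k : ℕ) (l : Fin k → ℂ),
      (∀ j : Fin k, IsAlgebraic ↥(IntermediateField.adjoin ℚ
        (l '' {i | i < j} ∪ Complex.exp '' (l '' {i | i < j}))) (l j)) ∧ a ∈ Set.range l :=
  ⟨{ carrier := {a | ∃ (k : ℕ) (l : Fin k → ℂ),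
         (∀ j : Fin k, IsAlgebraic ↥(IntermediateField.adjoin ℚ
           (l '' {i | i < j} ∪ Complex.exp '' (l '' {i | i < j}))) (l j)) ∧ a ∈ Set.range l}
     mul_mem' := fun ha hb => by
       obtain ⟨k, l, hl, ha, hb⟩ := exists_isConstr_pair ha hb
       exact exists_isConstr_of_mem hl (mul_mem (mem_adjoin_exp ha) (mem_adjoin_exp hb))
     one_mem' := exists_isConstr_of_mem isConstr_zero (one_mem _)
     add_mem' := fun ha hb => by
       obtain ⟨k, l, hl, ha, hb⟩ := exists_isConstr_pair ha hb
       exact exists_isConstr_of_mem hl (add_mem (mem_adjoin_exp ha) (mem_adjoin_exp hb))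
     zero_mem' := exists_isConstr_of_mem isConstr_zero (zero_mem _)
     algebraMap_mem' := fun q =>
       exists_isConstr_of_mem isConstr_zero (IntermediateField.algebraMap_mem _ q)
     inv_mem' := fun _ ha => by
       obtain ⟨k, l, hl, ha⟩ := ha
       exact exists_isConstr_of_mem hl (inv_mem (mem_adjoin_exp ha)) },
    fun _ => Iff.rfl⟩

/-- Such an `H` is closed under `exp` (append `exp a`). -/
theorem exp_mem_of_mem_iff {H : IntermediateField ℚ ℂ}
    (hH : ∀ a : ℂ, a ∈ H ↔ ∃ (k : ℕ) (l : Fin k → ℂ),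
      (∀ j : Fin k, IsAlgebraic ↥(IntermediateField.adjoin ℚ
        (l '' {i | i < j} ∪ Complex.exp '' (l '' {i | i < j}))) (l j)) ∧ a ∈ Set.range l) :
    ∀ w ∈ H, Complex.exp w ∈ H := by
  intro w hw
  obtain ⟨k, l, hl, hw⟩ := (hH w).1 hw
  exact (hH _).2 (exists_isConstr_of_mem hl (exp_mem_adjoin_exp hw))

/-- Such an `H` is relatively algebraically closed in `ℂ`: the finitely many coefficients of a
polynomial over `H` are members of one construction sequence `l`, so the polynomial is defined
over `ℚ(range l, exp range l)`; append the root. -/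
theorem mem_of_isAlgebraic_of_mem_iff {H : IntermediateField ℚ ℂ}
    (hH : ∀ a : ℂ, a ∈ H ↔ ∃ (k : ℕ) (l : Fin k → ℂ),
      (∀ j : Fin k, IsAlgebraic ↥(IntermediateField.adjoin ℚ
        (l '' {i | i < j} ∪ Complex.exp '' (l '' {i | i < j}))) (l j)) ∧ a ∈ Set.range l) :
    ∀ w : ℂ, IsAlgebraic H w → w ∈ H := by
  -- adapted from `AclSubsetLogFreeCore.Negative.Komega_closed` (LogFreeCoreCountable.lean)
  rintro w ⟨p, hp0, hpw⟩
  obtain ⟨k, l, hl, hs⟩ := exists_isConstr_finset p.support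
    (fun j => ((p.coeff j : H) : ℂ)) fun j _ => (hH _).1 (p.coeff j).2
  have hcoeff : ∀ j, ((p.coeff j : H) : ℂ) ∈
      IntermediateField.adjoin ℚ (Set.range l ∪ Complex.exp '' Set.range l) := by
    intro j
    by_cases hj : j ∈ p.support
    · exact mem_adjoin_exp (hs j hj)
    · have : p.coeff j = 0 := by simpa [Polynomial.mem_support_iff] using hj
      rw [this]
      exact zero_mem _
  set p' : Polynomial ℂ := p.map (algebraMap H ℂ) with hp'
  have hlift : p' ∈ Polynomial.lifts (algebraMap
      (IntermediateField.adjoin ℚ (Set.range l ∪ Complex.exp '' Set.range l)) ℂ) := by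
    rw [Polynomial.lifts_iff_coeff_lifts]
    intro j
    rw [hp', Polynomial.coeff_map]
    exact ⟨⟨_, hcoeff j⟩, rfl⟩
  obtain ⟨q, hqmap, hqdeg⟩ := Polynomial.exists_degree_eq_of_mem_lifts hlift
  have hp'0 : p' ≠ 0 := by
    rw [hp']
    exact (Polynomial.map_ne_zero_iff (FaithfulSMul.algebraMap_injective H ℂ)).2 hp0
  have hq0 : q ≠ 0 := by
    rintro rfl
    rw [Polynomial.degree_zero] at hqdeg
    exact hp'0 (Polynomial.degree_eq_bot.1 hqdeg.symm)
  have hqw : Polynomial.aeval w q = 0 := by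
    rw [Polynomial.aeval_def, ← Polynomial.eval_map, hqmap, hp', Polynomial.eval_map,
      ← Polynomial.aeval_def]
    exact hpw
  exact (hH w).2 (exists_isConstr_of_isAlgebraic hl ⟨q, hq0, hqw⟩)

/-- **Membership in `M` = membership in an EA-construction sequence** (`M ≤ H` since `M` is the
`sInf` of the `exp`-closed relatively algebraically closed fields; `H ≤ M` by
`mem_kernelFreeCore_of_isConstr`). -/
theorem mem_kernelFreeCore_iff_exists_isConstr {a : ℂ} :
    a ∈ kernelFreeCore ↔ ∃ (k : ℕ) (l : Fin k → ℂ),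
      (∀ j : Fin k, IsAlgebraic ↥(IntermediateField.adjoin ℚ
        (l '' {i | i < j} ∪ Complex.exp '' (l '' {i | i < j}))) (l j)) ∧ a ∈ Set.range l := by
  obtain ⟨H, hH⟩ := exists_constrField
  exact ⟨fun ha => (hH a).1
      (kernelFreeCore_le (exp_mem_of_mem_iff hH) (mem_of_isAlgebraic_of_mem_iff hH) ha),
    fun ⟨_, _, hl, j, hj⟩ => hj ▸ mem_kernelFreeCore_of_isConstr hl j⟩

end Exhaust

/-- **Stub S3a of line `generic-period-fibre`** (registered on `stmt-Schanuel-0970`, signature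
verbatim): every element of the kernel-free core
`M = sInf {K | K exp-closed ∧ K relatively algebraically closed}` is a member of a finite
EA-construction sequence `l`, each `l j` algebraic over `ℚ(l i, exp (l i) : i < j)`.
The `sInf` is `kernelFreeCore` by `rfl`; `Exhaust.mem_kernelFreeCore_iff_exists_isConstr` is the
equivalence (members of construction sequences conversely lie in `M`). -/
theorem stub_kernelFreeCore_exhaust :
    ∀ a ∈ (sInf {K : IntermediateField ℚ ℂ | (∀ w ∈ K, Complex.exp w ∈ K) ∧
        ∀ w : ℂ, IsAlgebraic K w → w ∈ K} : IntermediateField ℚ ℂ),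
      ∃ (k : ℕ) (l : Fin k → ℂ), a ∈ Set.range l ∧
        ∀ j : Fin k, IsAlgebraic
          ↥(IntermediateField.adjoin ℚ (l '' {i | i < j} ∪ Complex.exp '' (l '' {i | i < j}))) (l j) := by
  intro a ha
  obtain ⟨k, l, hl, hal⟩ :=
    Exhaust.mem_kernelFreeCore_iff_exists_isConstr.1 (show a ∈ kernelFreeCore from ha)
  exact ⟨k, l, hal, hl⟩

end Summit.Schanuel.Schanuel.Theorems.RigidCore

end
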